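import Mathlib
import HarnessLib

/-!
# KL programme — K3 ENGINE child (`KLRegimeEngineV17F2`, stmt-HubbardSuperconductivity-20437), stub (b) weighted lines, cure (c-D): the five THRESHOLD
# CONDITIONS of the (c-D) chain DISCHARGED at the harmless depth `m₀(j) = 2j + 5 + ⌈log₄U⁻²⌉` — one `U₀`-type smallness condition each

Cell `gate-hubbard-kl`, seat hubbard-kl-k3c3-p2 (g9); v2 token #19 (`klCDBase`, `…EngineWtBudgetF`); located risk «(b)-Wt@j≥1»; evidence #48 CD-LIMITS.
`…EngineSliceSpaceMoment(ScaleWt)` asks, at the base depth `m₀`, for `3X₁ ≤ k₁G₃x`, `3X₂ ≤ k₁G₃x²`, `3X₃ ≤ k₁G₃x³`, `2Y₁ ≤ k₁G₂x`, `2Y₂ ≤ k₁G₂x²`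
(`x = 4^{m₀}`; `…SectorSliceIncrRates`).  In the flow's currency — `k_r = κ_r/Λ_j^{r+1}` (slice constants), `G₀ = Gfr₀·|U|`, `G_i = Gfr_i·U²` (`i ≥ 1`),
multiplier scale data `α_k = a_k/Λ_j^k`, band constants `b` — every monomial of `X_i`, `Y_i` carries `|U|^p/Λ_j^q` with `p ≥ 1`, `q ≤ 5`, while at
`m ≥ m₀(j)` one has `x ≥ 4^{2j+5}/U² = 1024e₀²/(U²Λ_j²)` (`Λ_j = e₀4^{−j}`), so `k₁G x^i ≥ 1024^i κ₁ g e₀^{2i}·|U|^{2−2i}·Λ_j^{−2−2i}` DOMINATES each monomial by a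
power of `|U|` — uniformly in `j` (E1-WORD10 (W1)/(W3): the thresholds are `U₀`-conditions, not `n`- or `j`-conditions):

* **`cd_threshold_X1/X2/Y1/Y2`** (this file) / **`cd_threshold_X3`** (`…EngineCDThresholdsX3`) — each threshold from ONE explicit condition `N·|U|·S ≤ 1024^i κ₁ g e₀^{2i}` (`S` a `|U|`-free polynomial in
  `κ, Gfr, a, b, e₀`), for every `x` with `1024e₀² ≤ x·U²Λ²`, `0 < Λ ≤ e₀`, `0 < |U| ≤ 1`;
* **`cd_depth_lower`** — `klCDBase`-free form of the depth: `m ≥ 2j + 5 + ⌈log₄(U²)⁻¹⌉₊ ⇒ 1024·e₀² ≤ 4^m·(U²·(klScale e₀ j)²)`.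

Pure real algebra; no definitions, no sorry.  Nothing asserts superconductivity.
-/

noncomputable section

namespace Summit.HubbardSuperconductivity.HubbardSuperconductivity.Theorems.EngineV8

set_option linter.dupNamespace false -- summit = problem name (single-conjunct summit), D-0017

open Real


/-- **Threshold `X1` at the (c-D) depth**: in the flow currency (`k_r = κ_r/Λ^{r+1}`, `G₀ = g₀u`, `G_i = g_iu²` (`i ≥ 1`), `α_k = a_k/Λ^k`, `0 < u = |U| ≤ 1`,
`0 < Λ ≤ e₀`) the condition `3·X1 ≤ k₁G₃·x` holds for every depth `x` with `1024e₀² ≤ x·u²Λ²` (i.e. `x = 4^m`, `m ≥ m₀(j) = 2j+5+⌈log₄U⁻²⌉`,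
`Λ = Λ_j`) as soon as ONE `u`-free smallness condition `3·u·S ≤ 1024·κ₁g₃·e₀^2` holds (`S` explicit below). -/
theorem cd_threshold_X1 {{κ₁ κ₂ g₁ g₂ g₃ a₁ b₁ b₂' e₀ Λ u x k₁ k₂ G₁ G₂ G₃ α₁ : ℝ}}
    (hκ₁ : 0 ≤ κ₁) (hκ₂ : 0 ≤ κ₂) (hg₁ : 0 ≤ g₁) (hg₂ : 0 ≤ g₂) (hg₃ : 0 ≤ g₃) (ha₁ : 0 ≤ a₁) (hb₁ : 0 ≤ b₁) (hb₂' : 0 ≤ b₂')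
    (hΛ : 0 < Λ) (hΛe : Λ ≤ e₀) (hu0 : 0 < u) (hu1 : u ≤ 1) (hx : 1024 * e₀ ^ 2 ≤ x * (u ^ 2 * Λ ^ 2))
    (hk₁ : k₁ = κ₁ / Λ ^ 2) (hk₂ : k₂ = κ₂ / Λ ^ 3) (hG₁ : G₁ = g₁ * u ^ 2) (hG₂ : G₂ = g₂ * u ^ 2) (hG₃ : G₃ = g₃ * u ^ 2) (hα₁ : α₁ = a₁ / Λ)
    (hU : 3 * (u * (3 * b₂' * g₁ * κ₂ * e₀ + 3 * a₁ * g₂ * κ₁ * e₀ + 3 * b₁ * g₂ * κ₂ * e₀)) ≤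
      1024 * κ₁ * g₃ * e₀ ^ 2) :
    3 * (3 * G₁ * k₂ * b₂' + 3 * G₂ * k₁ * α₁ + 3 * G₂ * k₂ * b₁) ≤ k₁ * G₃ * x := by
  subst hk₁ hk₂ hG₁ hG₂ hG₃ hα₁
  have he : 0 < e₀ := lt_of_lt_of_le hΛ hΛe
  have t0 : (3 * b₂' * g₁ * κ₂) * u ^ 2 * Λ ^ 1 ≤ (3 * b₂' * g₁ * κ₂ * e₀) * u :=
    le_of_le_of_eq (mul_le_mul (mul_le_mul_of_nonneg_left (pow_le_of_le_one hu0.le hu1 (by norm_num)) (by positivity))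
      (pow_le_pow_left₀ hΛ.le hΛe 1) (by positivity) (by positivity)) (by ring)
  have t1 : (3 * a₁ * g₂ * κ₁) * u ^ 2 * Λ ^ 1 ≤ (3 * a₁ * g₂ * κ₁ * e₀) * u :=
    le_of_le_of_eq (mul_le_mul (mul_le_mul_of_nonneg_left (pow_le_of_le_one hu0.le hu1 (by norm_num)) (by positivity))
      (pow_le_pow_left₀ hΛ.le hΛe 1) (by positivity) (by positivity)) (by ring)
  have t2 : (3 * b₁ * g₂ * κ₂) * u ^ 2 * Λ ^ 1 ≤ (3 * b₁ * g₂ * κ₂ * e₀) * u :=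
    le_of_le_of_eq (mul_le_mul (mul_le_mul_of_nonneg_left (pow_le_of_le_one hu0.le hu1 (by norm_num)) (by positivity))
      (pow_le_pow_left₀ hΛ.le hΛe 1) (by positivity) (by positivity)) (by ring)
  have hS : (3 * (g₁ * u ^ 2) * (κ₂ / Λ ^ 3) * b₂' + 3 * (g₂ * u ^ 2) * (κ₁ / Λ ^ 2) * (a₁ / Λ) + 3 * (g₂ * u ^ 2) * (κ₂ / Λ ^ 3) * b₁) * Λ ^ 4 ≤
      (3 * b₂' * g₁ * κ₂ * e₀ + 3 * a₁ * g₂ * κ₁ * e₀ + 3 * b₁ * g₂ * κ₂ * e₀) * u := by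
    have e : (3 * (g₁ * u ^ 2) * (κ₂ / Λ ^ 3) * b₂' + 3 * (g₂ * u ^ 2) * (κ₁ / Λ ^ 2) * (a₁ / Λ) + 3 * (g₂ * u ^ 2) * (κ₂ / Λ ^ 3) * b₁) * Λ ^ 4 =
        (3 * b₂' * g₁ * κ₂) * u ^ 2 * Λ ^ 1 + (3 * a₁ * g₂ * κ₁) * u ^ 2 * Λ ^ 1 + (3 * b₁ * g₂ * κ₂) * u ^ 2 * Λ ^ 1 := by
      field_simp
    rw [e]
    linarith only [t0, t1, t2]
  have hT : 1024 * κ₁ * g₃ * e₀ ^ 2 ≤ κ₁ / Λ ^ 2 * (g₃ * u ^ 2) * x * Λ ^ 4 := by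
    have hxi : (1024 * e₀ ^ 2) ^ 1 ≤ (x * (u ^ 2 * Λ ^ 2)) ^ 1 := pow_le_pow_left₀ (by positivity) hx 1
    calc 1024 * κ₁ * g₃ * e₀ ^ 2 = κ₁ * g₃ * (1024 * e₀ ^ 2) ^ 1 := by ring
      _ ≤ κ₁ * g₃ * (x * (u ^ 2 * Λ ^ 2)) ^ 1 := mul_le_mul_of_nonneg_left hxi (by positivity)
      _ = κ₁ / Λ ^ 2 * (g₃ * u ^ 2) * x * Λ ^ 4 := by field_simp
  have hw : 0 < Λ ^ 4 := by positivity
  refine le_of_mul_le_mul_right ?_ hw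
  calc 3 * (3 * (g₁ * u ^ 2) * (κ₂ / Λ ^ 3) * b₂' + 3 * (g₂ * u ^ 2) * (κ₁ / Λ ^ 2) * (a₁ / Λ) + 3 * (g₂ * u ^ 2) * (κ₂ / Λ ^ 3) * b₁) * Λ ^ 4 = 3 * ((3 * (g₁ * u ^ 2) * (κ₂ / Λ ^ 3) * b₂' + 3 * (g₂ * u ^ 2) * (κ₁ / Λ ^ 2) * (a₁ / Λ) + 3 * (g₂ * u ^ 2) * (κ₂ / Λ ^ 3) * b₁) * Λ ^ 4) := by ring
    _ ≤ 3 * ((3 * b₂' * g₁ * κ₂ * e₀ + 3 * a₁ * g₂ * κ₁ * e₀ + 3 * b₁ * g₂ * κ₂ * e₀) * u) := mul_le_mul_of_nonneg_left hS (by norm_num)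
    _ = 3 * (u * (3 * b₂' * g₁ * κ₂ * e₀ + 3 * a₁ * g₂ * κ₁ * e₀ + 3 * b₁ * g₂ * κ₂ * e₀)) := by ring
    _ ≤ 1024 * κ₁ * g₃ * e₀ ^ 2 := hU
    _ ≤ κ₁ / Λ ^ 2 * (g₃ * u ^ 2) * x * Λ ^ 4 := hT



/-- **Threshold `X2` at the (c-D) depth**: in the flow currency (`k_r = κ_r/Λ^{r+1}`, `G₀ = g₀u`, `G_i = g_iu²` (`i ≥ 1`), `α_k = a_k/Λ^k`, `0 < u = |U| ≤ 1`,
`0 < Λ ≤ e₀`) the condition `3·X2 ≤ k₁G₃·x^2` holds for every depth `x` with `1024e₀² ≤ x·u²Λ²` (i.e. `x = 4^m`, `m ≥ m₀(j) = 2j+5+⌈log₄U⁻²⌉`,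
`Λ = Λ_j`) as soon as ONE `u`-free smallness condition `3·u·S ≤ 1048576·κ₁g₃·e₀^4` holds (`S` explicit below). -/
theorem cd_threshold_X2 {{κ₁ κ₂ κ₃ g₀ g₁ g₂ g₃ a₁ a₂ b₁ b₂ b₂' b₃' e₀ Λ u x k₁ k₂ k₃ G₀ G₁ G₂ G₃ α₁ α₂ : ℝ}}
    (hκ₁ : 0 ≤ κ₁) (hκ₂ : 0 ≤ κ₂) (hκ₃ : 0 ≤ κ₃) (hg₀ : 0 ≤ g₀) (hg₁ : 0 ≤ g₁) (hg₂ : 0 ≤ g₂) (hg₃ : 0 ≤ g₃) (ha₁ : 0 ≤ a₁) (ha₂ : 0 ≤ a₂) (hb₁ : 0 ≤ b₁) (hb₂ : 0 ≤ b₂) (hb₂' : 0 ≤ b₂') (hb₃' : 0 ≤ b₃')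
    (hΛ : 0 < Λ) (hΛe : Λ ≤ e₀) (hu0 : 0 < u) (hu1 : u ≤ 1) (hx : 1024 * e₀ ^ 2 ≤ x * (u ^ 2 * Λ ^ 2))
    (hk₁ : k₁ = κ₁ / Λ ^ 2) (hk₂ : k₂ = κ₂ / Λ ^ 3) (hk₃ : k₃ = κ₃ / Λ ^ 4) (hG₀ : G₀ = g₀ * u) (hG₁ : G₁ = g₁ * u ^ 2) (hG₂ : G₂ = g₂ * u ^ 2) (hG₃ : G₃ = g₃ * u ^ 2) (hα₁ : α₁ = a₁ / Λ) (hα₂ : α₂ = a₂ / Λ ^ 2)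
    (hU : 3 * (u * (3 * a₁ * b₂' * g₀ * κ₂ * e₀ ^ 2 + 3 * b₁ * b₂' * g₀ * κ₃ * e₀ ^ 2 + 6 * a₁ * b₁ * g₁ * κ₂ * e₀ ^ 2 + 3 * b₁ ^ 2 * g₁ * κ₃ * e₀ ^ 2 + g₀ * g₃ * κ₂ * e₀ ^ 3 + b₃' * g₀ * κ₂ * e₀ ^ 3 + 3 * g₁ * g₂ * κ₂ * e₀ ^ 3 + 3 * a₂ * g₁ * κ₁ * e₀ ^ 2 + 3 * b₂ * g₁ * κ₂ * e₀ ^ 3)) ≤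
      1048576 * κ₁ * g₃ * e₀ ^ 4) :
    3 * (3 * G₀ * k₂ * α₁ * b₂' + 3 * G₀ * k₃ * b₁ * b₂' + 6 * G₁ * k₂ * α₁ * b₁ + 3 * G₁ * k₃ * b₁ ^ 2 + G₀ * G₃ * k₂ + G₀ * k₂ * b₃' + 3 * G₁ * G₂ * k₂ + 3 * G₁ * k₁ * α₂ + 3 * G₁ * k₂ * b₂) ≤ k₁ * G₃ * x ^ 2 := by
  subst hk₁ hk₂ hk₃ hG₀ hG₁ hG₂ hG₃ hα₁ hα₂
  have he : 0 < e₀ := lt_of_lt_of_le hΛ hΛe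
  have t0 : (3 * a₁ * b₂' * g₀ * κ₂) * u ^ 3 * Λ ^ 2 ≤ (3 * a₁ * b₂' * g₀ * κ₂ * e₀ ^ 2) * u :=
    le_of_le_of_eq (mul_le_mul (mul_le_mul_of_nonneg_left (pow_le_of_le_one hu0.le hu1 (by norm_num)) (by positivity))
      (pow_le_pow_left₀ hΛ.le hΛe 2) (by positivity) (by positivity)) (by ring)
  have t1 : (3 * b₁ * b₂' * g₀ * κ₃) * u ^ 3 * Λ ^ 2 ≤ (3 * b₁ * b₂' * g₀ * κ₃ * e₀ ^ 2) * u :=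
    le_of_le_of_eq (mul_le_mul (mul_le_mul_of_nonneg_left (pow_le_of_le_one hu0.le hu1 (by norm_num)) (by positivity))
      (pow_le_pow_left₀ hΛ.le hΛe 2) (by positivity) (by positivity)) (by ring)
  have t2 : (6 * a₁ * b₁ * g₁ * κ₂) * u ^ 4 * Λ ^ 2 ≤ (6 * a₁ * b₁ * g₁ * κ₂ * e₀ ^ 2) * u :=
    le_of_le_of_eq (mul_le_mul (mul_le_mul_of_nonneg_left (pow_le_of_le_one hu0.le hu1 (by norm_num)) (by positivity))
      (pow_le_pow_left₀ hΛ.le hΛe 2) (by positivity) (by positivity)) (by ring)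
  have t3 : (3 * b₁ ^ 2 * g₁ * κ₃) * u ^ 4 * Λ ^ 2 ≤ (3 * b₁ ^ 2 * g₁ * κ₃ * e₀ ^ 2) * u :=
    le_of_le_of_eq (mul_le_mul (mul_le_mul_of_nonneg_left (pow_le_of_le_one hu0.le hu1 (by norm_num)) (by positivity))
      (pow_le_pow_left₀ hΛ.le hΛe 2) (by positivity) (by positivity)) (by ring)
  have t4 : (g₀ * g₃ * κ₂) * u ^ 5 * Λ ^ 3 ≤ (g₀ * g₃ * κ₂ * e₀ ^ 3) * u :=
    le_of_le_of_eq (mul_le_mul (mul_le_mul_of_nonneg_left (pow_le_of_le_one hu0.le hu1 (by norm_num)) (by positivity))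
      (pow_le_pow_left₀ hΛ.le hΛe 3) (by positivity) (by positivity)) (by ring)
  have t5 : (b₃' * g₀ * κ₂) * u ^ 3 * Λ ^ 3 ≤ (b₃' * g₀ * κ₂ * e₀ ^ 3) * u :=
    le_of_le_of_eq (mul_le_mul (mul_le_mul_of_nonneg_left (pow_le_of_le_one hu0.le hu1 (by norm_num)) (by positivity))
      (pow_le_pow_left₀ hΛ.le hΛe 3) (by positivity) (by positivity)) (by ring)
  have t6 : (3 * g₁ * g₂ * κ₂) * u ^ 6 * Λ ^ 3 ≤ (3 * g₁ * g₂ * κ₂ * e₀ ^ 3) * u :=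
    le_of_le_of_eq (mul_le_mul (mul_le_mul_of_nonneg_left (pow_le_of_le_one hu0.le hu1 (by norm_num)) (by positivity))
      (pow_le_pow_left₀ hΛ.le hΛe 3) (by positivity) (by positivity)) (by ring)
  have t7 : (3 * a₂ * g₁ * κ₁) * u ^ 4 * Λ ^ 2 ≤ (3 * a₂ * g₁ * κ₁ * e₀ ^ 2) * u :=
    le_of_le_of_eq (mul_le_mul (mul_le_mul_of_nonneg_left (pow_le_of_le_one hu0.le hu1 (by norm_num)) (by positivity))
      (pow_le_pow_left₀ hΛ.le hΛe 2) (by positivity) (by positivity)) (by ring)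
  have t8 : (3 * b₂ * g₁ * κ₂) * u ^ 4 * Λ ^ 3 ≤ (3 * b₂ * g₁ * κ₂ * e₀ ^ 3) * u :=
    le_of_le_of_eq (mul_le_mul (mul_le_mul_of_nonneg_left (pow_le_of_le_one hu0.le hu1 (by norm_num)) (by positivity))
      (pow_le_pow_left₀ hΛ.le hΛe 3) (by positivity) (by positivity)) (by ring)
  have hS : (3 * (g₀ * u) * (κ₂ / Λ ^ 3) * (a₁ / Λ) * b₂' + 3 * (g₀ * u) * (κ₃ / Λ ^ 4) * b₁ * b₂' + 6 * (g₁ * u ^ 2) * (κ₂ / Λ ^ 3) * (a₁ / Λ) * b₁ + 3 * (g₁ * u ^ 2) * (κ₃ / Λ ^ 4) * b₁ ^ 2 + (g₀ * u) * (g₃ * u ^ 2) * (κ₂ / Λ ^ 3) + (g₀ * u) * (κ₂ / Λ ^ 3) * b₃' + 3 * (g₁ * u ^ 2) * (g₂ * u ^ 2) * (κ₂ / Λ ^ 3) + 3 * (g₁ * u ^ 2) * (κ₁ / Λ ^ 2) * (a₂ / Λ ^ 2) + 3 * (g₁ * u ^ 2) * (κ₂ / Λ ^ 3) * b₂) * (u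 ^ 2 * Λ ^ 6) ≤
      (3 * a₁ * b₂' * g₀ * κ₂ * e₀ ^ 2 + 3 * b₁ * b₂' * g₀ * κ₃ * e₀ ^ 2 + 6 * a₁ * b₁ * g₁ * κ₂ * e₀ ^ 2 + 3 * b₁ ^ 2 * g₁ * κ₃ * e₀ ^ 2 + g₀ * g₃ * κ₂ * e₀ ^ 3 + b₃' * g₀ * κ₂ * e₀ ^ 3 + 3 * g₁ * g₂ * κ₂ * e₀ ^ 3 + 3 * a₂ * g₁ * κ₁ * e₀ ^ 2 + 3 * b₂ * g₁ * κ₂ * e₀ ^ 3) * u := by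
    have e : (3 * (g₀ * u) * (κ₂ / Λ ^ 3) * (a₁ / Λ) * b₂' + 3 * (g₀ * u) * (κ₃ / Λ ^ 4) * b₁ * b₂' + 6 * (g₁ * u ^ 2) * (κ₂ / Λ ^ 3) * (a₁ / Λ) * b₁ + 3 * (g₁ * u ^ 2) * (κ₃ / Λ ^ 4) * b₁ ^ 2 + (g₀ * u) * (g₃ * u ^ 2) * (κ₂ / Λ ^ 3) + (g₀ * u) * (κ₂ / Λ ^ 3) * b₃' + 3 * (g₁ * u ^ 2) * (g₂ * u ^ 2) * (κ₂ / Λ ^ 3) + 3 * (g₁ * u ^ 2) * (κ₁ / Λ ^ 2) * (a₂ / Λ ^ 2) + 3 * (g₁ * u ^ 2) * (κ₂ / Λ ^ 3) * b₂) * (u ^ 2 * Λ ^ 6) =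
        (3 * a₁ * b₂' * g₀ * κ₂) * u ^ 3 * Λ ^ 2 + (3 * b₁ * b₂' * g₀ * κ₃) * u ^ 3 * Λ ^ 2 + (6 * a₁ * b₁ * g₁ * κ₂) * u ^ 4 * Λ ^ 2 + (3 * b₁ ^ 2 * g₁ * κ₃) * u ^ 4 * Λ ^ 2 + (g₀ * g₃ * κ₂) * u ^ 5 * Λ ^ 3 + (b₃' * g₀ * κ₂) * u ^ 3 * Λ ^ 3 + (3 * g₁ * g₂ * κ₂) * u ^ 6 * Λ ^ 3 + (3 * a₂ * g₁ * κ₁) * u ^ 4 * Λ ^ 2 + (3 * b₂ * g₁ * κ₂) * u ^ 4 * Λ ^ 3 := by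
      field_simp
    rw [e]
    linarith only [t0, t1, t2, t3, t4, t5, t6, t7, t8]
  have hT : 1048576 * κ₁ * g₃ * e₀ ^ 4 ≤ κ₁ / Λ ^ 2 * (g₃ * u ^ 2) * x ^ 2 * (u ^ 2 * Λ ^ 6) := by
    have hxi : (1024 * e₀ ^ 2) ^ 2 ≤ (x * (u ^ 2 * Λ ^ 2)) ^ 2 := pow_le_pow_left₀ (by positivity) hx 2
    calc 1048576 * κ₁ * g₃ * e₀ ^ 4 = κ₁ * g₃ * (1024 * e₀ ^ 2) ^ 2 := by ring
      _ ≤ κ₁ * g₃ * (x * (u ^ 2 * Λ ^ 2)) ^ 2 := mul_le_mul_of_nonneg_left hxi (by positivity)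
      _ = κ₁ / Λ ^ 2 * (g₃ * u ^ 2) * x ^ 2 * (u ^ 2 * Λ ^ 6) := by field_simp
  have hw : 0 < (u ^ 2 * Λ ^ 6) := by positivity
  refine le_of_mul_le_mul_right ?_ hw
  calc 3 * (3 * (g₀ * u) * (κ₂ / Λ ^ 3) * (a₁ / Λ) * b₂' + 3 * (g₀ * u) * (κ₃ / Λ ^ 4) * b₁ * b₂' + 6 * (g₁ * u ^ 2) * (κ₂ / Λ ^ 3) * (a₁ / Λ) * b₁ + 3 * (g₁ * u ^ 2) * (κ₃ / Λ ^ 4) * b₁ ^ 2 + (g₀ * u) * (g₃ * u ^ 2) * (κ₂ / Λ ^ 3) + (g₀ * u) * (κ₂ / Λ ^ 3) * b₃' + 3 * (g₁ * u ^ 2) * (g₂ * u ^ 2) * (κ₂ / Λ ^ 3) + 3 * (g₁ * u ^ 2) * (κ₁ / Λ ^ 2) * (a₂ / Λ ^ 2) + 3 * (g₁ * u ^ 2) * (κ₂ / Λ ^ 3) * b₂) * (u ^ 2 * Λ ^ 6) = 3 * ((3 * (g₀ * u) * (κ₂ / Λ ^ 3) * (a₁ / Λ) * b₂' + 3 * (g₀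 * u) * (κ₃ / Λ ^ 4) * b₁ * b₂' + 6 * (g₁ * u ^ 2) * (κ₂ / Λ ^ 3) * (a₁ / Λ) * b₁ + 3 * (g₁ * u ^ 2) * (κ₃ / Λ ^ 4) * b₁ ^ 2 + (g₀ * u) * (g₃ * u ^ 2) * (κ₂ / Λ ^ 3) + (g₀ * u) * (κ₂ / Λ ^ 3) * b₃' + 3 * (g₁ * u ^ 2) * (g₂ * u ^ 2) * (κ₂ / Λ ^ 3) + 3 * (g₁ * u ^ 2) * (κ₁ / Λ ^ 2) * (a₂ / Λ ^ 2) + 3 * (g₁ * u ^ 2) * (κ₂ / Λ ^ 3) * b₂) * (u ^ 2 * Λ ^ 6)) := by ring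
    _ ≤ 3 * ((3 * a₁ * b₂' * g₀ * κ₂ * e₀ ^ 2 + 3 * b₁ * b₂' * g₀ * κ₃ * e₀ ^ 2 + 6 * a₁ * b₁ * g₁ * κ₂ * e₀ ^ 2 + 3 * b₁ ^ 2 * g₁ * κ₃ * e₀ ^ 2 + g₀ * g₃ * κ₂ * e₀ ^ 3 + b₃' * g₀ * κ₂ * e₀ ^ 3 + 3 * g₁ * g₂ * κ₂ * e₀ ^ 3 + 3 * a₂ * g₁ * κ₁ * e₀ ^ 2 + 3 * b₂ * g₁ * κ₂ * e₀ ^ 3) * u) := mul_le_mul_of_nonneg_left hS (by norm_num)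
    _ = 3 * (u * (3 * a₁ * b₂' * g₀ * κ₂ * e₀ ^ 2 + 3 * b₁ * b₂' * g₀ * κ₃ * e₀ ^ 2 + 6 * a₁ * b₁ * g₁ * κ₂ * e₀ ^ 2 + 3 * b₁ ^ 2 * g₁ * κ₃ * e₀ ^ 2 + g₀ * g₃ * κ₂ * e₀ ^ 3 + b₃' * g₀ * κ₂ * e₀ ^ 3 + 3 * g₁ * g₂ * κ₂ * e₀ ^ 3 + 3 * a₂ * g₁ * κ₁ * e₀ ^ 2 + 3 * b₂ * g₁ * κ₂ * e₀ ^ 3)) := by ring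
    _ ≤ 1048576 * κ₁ * g₃ * e₀ ^ 4 := hU
    _ ≤ κ₁ / Λ ^ 2 * (g₃ * u ^ 2) * x ^ 2 * (u ^ 2 * Λ ^ 6) := hT



/-- **Threshold `Y1` at the (c-D) depth**: in the flow currency (`k_r = κ_r/Λ^{r+1}`, `G₀ = g₀u`, `G_i = g_iu²` (`i ≥ 1`), `α_k = a_k/Λ^k`, `0 < u = |U| ≤ 1`,
`0 < Λ ≤ e₀`) the condition `2·Y1 ≤ k₁G₂·x` holds for every depth `x` with `1024e₀² ≤ x·u²Λ²` (i.e. `x = 4^m`, `m ≥ m₀(j) = 2j+5+⌈log₄U⁻²⌉`,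
`Λ = Λ_j`) as soon as ONE `u`-free smallness condition `2·u·S ≤ 1024·κ₁g₂·e₀^2` holds (`S` explicit below). -/
theorem cd_threshold_Y1 {{κ₁ κ₂ g₀ g₁ g₂ a₁ b₁ b₂' e₀ Λ u x k₁ k₂ G₀ G₁ G₂ α₁ : ℝ}}
    (hκ₁ : 0 ≤ κ₁) (hκ₂ : 0 ≤ κ₂) (hg₀ : 0 ≤ g₀) (hg₁ : 0 ≤ g₁) (hg₂ : 0 ≤ g₂) (ha₁ : 0 ≤ a₁) (hb₁ : 0 ≤ b₁) (hb₂' : 0 ≤ b₂')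
    (hΛ : 0 < Λ) (hΛe : Λ ≤ e₀) (hu0 : 0 < u) (hu1 : u ≤ 1) (hx : 1024 * e₀ ^ 2 ≤ x * (u ^ 2 * Λ ^ 2))
    (hk₁ : k₁ = κ₁ / Λ ^ 2) (hk₂ : k₂ = κ₂ / Λ ^ 3) (hG₀ : G₀ = g₀ * u) (hG₁ : G₁ = g₁ * u ^ 2) (hG₂ : G₂ = g₂ * u ^ 2) (hα₁ : α₁ = a₁ / Λ)
    (hU : 2 * (u * (b₂' * g₀ * κ₂ * e₀ + 2 * a₁ * g₁ * κ₁ * e₀ + 2 * b₁ * g₁ * κ₂ * e₀)) ≤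
      1024 * κ₁ * g₂ * e₀ ^ 2) :
    2 * (G₀ * k₂ * b₂' + 2 * G₁ * k₁ * α₁ + 2 * G₁ * k₂ * b₁) ≤ k₁ * G₂ * x := by
  subst hk₁ hk₂ hG₀ hG₁ hG₂ hα₁
  have he : 0 < e₀ := lt_of_lt_of_le hΛ hΛe
  have t0 : (b₂' * g₀ * κ₂) * u * Λ ^ 1 ≤ (b₂' * g₀ * κ₂ * e₀) * u :=
    le_of_le_of_eq (mul_le_mul (mul_le_mul_of_nonneg_left le_rfl (by positivity))
      (pow_le_pow_left₀ hΛ.le hΛe 1) (by positivity) (by positivity)) (by ring)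
  have t1 : (2 * a₁ * g₁ * κ₁) * u ^ 2 * Λ ^ 1 ≤ (2 * a₁ * g₁ * κ₁ * e₀) * u :=
    le_of_le_of_eq (mul_le_mul (mul_le_mul_of_nonneg_left (pow_le_of_le_one hu0.le hu1 (by norm_num)) (by positivity))
      (pow_le_pow_left₀ hΛ.le hΛe 1) (by positivity) (by positivity)) (by ring)
  have t2 : (2 * b₁ * g₁ * κ₂) * u ^ 2 * Λ ^ 1 ≤ (2 * b₁ * g₁ * κ₂ * e₀) * u :=
    le_of_le_of_eq (mul_le_mul (mul_le_mul_of_nonneg_left (pow_le_of_le_one hu0.le hu1 (by norm_num)) (by positivity))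
      (pow_le_pow_left₀ hΛ.le hΛe 1) (by positivity) (by positivity)) (by ring)
  have hS : ((g₀ * u) * (κ₂ / Λ ^ 3) * b₂' + 2 * (g₁ * u ^ 2) * (κ₁ / Λ ^ 2) * (a₁ / Λ) + 2 * (g₁ * u ^ 2) * (κ₂ / Λ ^ 3) * b₁) * Λ ^ 4 ≤
      (b₂' * g₀ * κ₂ * e₀ + 2 * a₁ * g₁ * κ₁ * e₀ + 2 * b₁ * g₁ * κ₂ * e₀) * u := by
    have e : ((g₀ * u) * (κ₂ / Λ ^ 3) * b₂' + 2 * (g₁ * u ^ 2) * (κ₁ / Λ ^ 2) * (a₁ / Λ) + 2 * (g₁ * u ^ 2) * (κ₂ / Λ ^ 3) * b₁) * Λ ^ 4 =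
        (b₂' * g₀ * κ₂) * u * Λ ^ 1 + (2 * a₁ * g₁ * κ₁) * u ^ 2 * Λ ^ 1 + (2 * b₁ * g₁ * κ₂) * u ^ 2 * Λ ^ 1 := by
      field_simp
    rw [e]
    linarith only [t0, t1, t2]
  have hT : 1024 * κ₁ * g₂ * e₀ ^ 2 ≤ κ₁ / Λ ^ 2 * (g₂ * u ^ 2) * x * Λ ^ 4 := by
    have hxi : (1024 * e₀ ^ 2) ^ 1 ≤ (x * (u ^ 2 * Λ ^ 2)) ^ 1 := pow_le_pow_left₀ (by positivity) hx 1
    calc 1024 * κ₁ * g₂ * e₀ ^ 2 = κ₁ * g₂ * (1024 * e₀ ^ 2) ^ 1 := by ring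
      _ ≤ κ₁ * g₂ * (x * (u ^ 2 * Λ ^ 2)) ^ 1 := mul_le_mul_of_nonneg_left hxi (by positivity)
      _ = κ₁ / Λ ^ 2 * (g₂ * u ^ 2) * x * Λ ^ 4 := by field_simp
  have hw : 0 < Λ ^ 4 := by positivity
  refine le_of_mul_le_mul_right ?_ hw
  calc 2 * ((g₀ * u) * (κ₂ / Λ ^ 3) * b₂' + 2 * (g₁ * u ^ 2) * (κ₁ / Λ ^ 2) * (a₁ / Λ) + 2 * (g₁ * u ^ 2) * (κ₂ / Λ ^ 3) * b₁) * Λ ^ 4 = 2 * (((g₀ * u) * (κ₂ / Λ ^ 3) * b₂' + 2 * (g₁ * u ^ 2) * (κ₁ / Λ ^ 2) * (a₁ / Λ) + 2 * (g₁ * u ^ 2) * (κ₂ / Λ ^ 3) * b₁) * Λ ^ 4) := by ring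
    _ ≤ 2 * ((b₂' * g₀ * κ₂ * e₀ + 2 * a₁ * g₁ * κ₁ * e₀ + 2 * b₁ * g₁ * κ₂ * e₀) * u) := mul_le_mul_of_nonneg_left hS (by norm_num)
    _ = 2 * (u * (b₂' * g₀ * κ₂ * e₀ + 2 * a₁ * g₁ * κ₁ * e₀ + 2 * b₁ * g₁ * κ₂ * e₀)) := by ring
    _ ≤ 1024 * κ₁ * g₂ * e₀ ^ 2 := hU
    _ ≤ κ₁ / Λ ^ 2 * (g₂ * u ^ 2) * x * Λ ^ 4 := hT



/-- **Threshold `Y2` at the (c-D) depth**: in the flow currency (`k_r = κ_r/Λ^{r+1}`, `G₀ = g₀u`, `G_i = g_iu²` (`i ≥ 1`), `α_k = a_k/Λ^k`, `0 < u = |U| ≤ 1`,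
`0 < Λ ≤ e₀`) the condition `2·Y2 ≤ k₁G₂·x^2` holds for every depth `x` with `1024e₀² ≤ x·u²Λ²` (i.e. `x = 4^m`, `m ≥ m₀(j) = 2j+5+⌈log₄U⁻²⌉`,
`Λ = Λ_j`) as soon as ONE `u`-free smallness condition `2·u·S ≤ 1048576·κ₁g₂·e₀^4` holds (`S` explicit below). -/
theorem cd_threshold_Y2 {{κ₁ κ₂ κ₃ g₀ g₁ g₂ a₁ a₂ b₁ b₂ e₀ Λ u x k₁ k₂ k₃ G₀ G₁ G₂ α₁ α₂ : ℝ}}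
    (hκ₁ : 0 ≤ κ₁) (hκ₂ : 0 ≤ κ₂) (hκ₃ : 0 ≤ κ₃) (hg₀ : 0 ≤ g₀) (hg₁ : 0 ≤ g₁) (hg₂ : 0 ≤ g₂) (ha₁ : 0 ≤ a₁) (ha₂ : 0 ≤ a₂) (hb₁ : 0 ≤ b₁) (hb₂ : 0 ≤ b₂)
    (hΛ : 0 < Λ) (hΛe : Λ ≤ e₀) (hu0 : 0 < u) (hu1 : u ≤ 1) (hx : 1024 * e₀ ^ 2 ≤ x * (u ^ 2 * Λ ^ 2))
    (hk₁ : k₁ = κ₁ / Λ ^ 2) (hk₂ : k₂ = κ₂ / Λ ^ 3) (hk₃ : k₃ = κ₃ / Λ ^ 4) (hG₀ : G₀ = g₀ * u) (hG₁ : G₁ = g₁ * u ^ 2) (hG₂ : G₂ = g₂ * u ^ 2) (hα₁ : α₁ = a₁ / Λ) (hα₂ : α₂ = a₂ / Λ ^ 2)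
    (hU : 2 * (u * (2 * a₁ * b₁ * g₀ * κ₂ * e₀ ^ 2 + b₁ ^ 2 * g₀ * κ₃ * e₀ ^ 2 + g₀ * g₂ * κ₂ * e₀ ^ 3 + a₂ * g₀ * κ₁ * e₀ ^ 2 + b₂ * g₀ * κ₂ * e₀ ^ 3 + g₁ ^ 2 * κ₂ * e₀ ^ 3 + 2 * a₁ * g₀ * g₁ * κ₂ * e₀ ^ 2 + 2 * b₁ * g₀ * g₁ * κ₃ * e₀ ^ 2 + g₀ * g₁ ^ 2 * κ₃ * e₀ ^ 2)) ≤
      1048576 * κ₁ * g₂ * e₀ ^ 4) :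
    2 * ((2 * G₀ * k₂ * α₁ * b₁ + G₀ * k₃ * b₁ ^ 2 + G₀ * G₂ * k₂ + G₀ * k₁ * α₂ + G₀ * k₂ * b₂ + G₁ ^ 2 * k₂) + (2 * G₀ * G₁ * k₂ * α₁ + 2 * G₀ * G₁ * k₃ * b₁) + (G₀ * G₁ ^ 2 * k₃)) ≤ k₁ * G₂ * x ^ 2 := by
  subst hk₁ hk₂ hk₃ hG₀ hG₁ hG₂ hα₁ hα₂
  have he : 0 < e₀ := lt_of_lt_of_le hΛ hΛe
  have t0 : (2 * a₁ * b₁ * g₀ * κ₂) * u ^ 3 * Λ ^ 2 ≤ (2 * a₁ * b₁ * g₀ * κ₂ * e₀ ^ 2) * u :=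
    le_of_le_of_eq (mul_le_mul (mul_le_mul_of_nonneg_left (pow_le_of_le_one hu0.le hu1 (by norm_num)) (by positivity))
      (pow_le_pow_left₀ hΛ.le hΛe 2) (by positivity) (by positivity)) (by ring)
  have t1 : (b₁ ^ 2 * g₀ * κ₃) * u ^ 3 * Λ ^ 2 ≤ (b₁ ^ 2 * g₀ * κ₃ * e₀ ^ 2) * u :=
    le_of_le_of_eq (mul_le_mul (mul_le_mul_of_nonneg_left (pow_le_of_le_one hu0.le hu1 (by norm_num)) (by positivity))
      (pow_le_pow_left₀ hΛ.le hΛe 2) (by positivity) (by positivity)) (by ring)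
  have t2 : (g₀ * g₂ * κ₂) * u ^ 5 * Λ ^ 3 ≤ (g₀ * g₂ * κ₂ * e₀ ^ 3) * u :=
    le_of_le_of_eq (mul_le_mul (mul_le_mul_of_nonneg_left (pow_le_of_le_one hu0.le hu1 (by norm_num)) (by positivity))
      (pow_le_pow_left₀ hΛ.le hΛe 3) (by positivity) (by positivity)) (by ring)
  have t3 : (a₂ * g₀ * κ₁) * u ^ 3 * Λ ^ 2 ≤ (a₂ * g₀ * κ₁ * e₀ ^ 2) * u :=
    le_of_le_of_eq (mul_le_mul (mul_le_mul_of_nonneg_left (pow_le_of_le_one hu0.le hu1 (by norm_num)) (by positivity))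
      (pow_le_pow_left₀ hΛ.le hΛe 2) (by positivity) (by positivity)) (by ring)
  have t4 : (b₂ * g₀ * κ₂) * u ^ 3 * Λ ^ 3 ≤ (b₂ * g₀ * κ₂ * e₀ ^ 3) * u :=
    le_of_le_of_eq (mul_le_mul (mul_le_mul_of_nonneg_left (pow_le_of_le_one hu0.le hu1 (by norm_num)) (by positivity))
      (pow_le_pow_left₀ hΛ.le hΛe 3) (by positivity) (by positivity)) (by ring)
  have t5 : (g₁ ^ 2 * κ₂) * u ^ 6 * Λ ^ 3 ≤ (g₁ ^ 2 * κ₂ * e₀ ^ 3) * u :=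
    le_of_le_of_eq (mul_le_mul (mul_le_mul_of_nonneg_left (pow_le_of_le_one hu0.le hu1 (by norm_num)) (by positivity))
      (pow_le_pow_left₀ hΛ.le hΛe 3) (by positivity) (by positivity)) (by ring)
  have t6 : (2 * a₁ * g₀ * g₁ * κ₂) * u ^ 5 * Λ ^ 2 ≤ (2 * a₁ * g₀ * g₁ * κ₂ * e₀ ^ 2) * u :=
    le_of_le_of_eq (mul_le_mul (mul_le_mul_of_nonneg_left (pow_le_of_le_one hu0.le hu1 (by norm_num)) (by positivity))
      (pow_le_pow_left₀ hΛ.le hΛe 2) (by positivity) (by positivity)) (by ring)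
  have t7 : (2 * b₁ * g₀ * g₁ * κ₃) * u ^ 5 * Λ ^ 2 ≤ (2 * b₁ * g₀ * g₁ * κ₃ * e₀ ^ 2) * u :=
    le_of_le_of_eq (mul_le_mul (mul_le_mul_of_nonneg_left (pow_le_of_le_one hu0.le hu1 (by norm_num)) (by positivity))
      (pow_le_pow_left₀ hΛ.le hΛe 2) (by positivity) (by positivity)) (by ring)
  have t8 : (g₀ * g₁ ^ 2 * κ₃) * u ^ 7 * Λ ^ 2 ≤ (g₀ * g₁ ^ 2 * κ₃ * e₀ ^ 2) * u :=
    le_of_le_of_eq (mul_le_mul (mul_le_mul_of_nonneg_left (pow_le_of_le_one hu0.le hu1 (by norm_num)) (by positivity))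
      (pow_le_pow_left₀ hΛ.le hΛe 2) (by positivity) (by positivity)) (by ring)
  have hS : ((2 * (g₀ * u) * (κ₂ / Λ ^ 3) * (a₁ / Λ) * b₁ + (g₀ * u) * (κ₃ / Λ ^ 4) * b₁ ^ 2 + (g₀ * u) * (g₂ * u ^ 2) * (κ₂ / Λ ^ 3) + (g₀ * u) * (κ₁ / Λ ^ 2) * (a₂ / Λ ^ 2) + (g₀ * u) * (κ₂ / Λ ^ 3) * b₂ + (g₁ * u ^ 2) ^ 2 * (κ₂ / Λ ^ 3)) + (2 * (g₀ * u) * (g₁ * u ^ 2) * (κ₂ / Λ ^ 3) * (a₁ / Λ) + 2 * (g₀ * u) * (g₁ * u ^ 2) * (κ₃ / Λ ^ 4) * b₁) + ((g₀ * u) * (g₁ * u ^ 2) ^ 2 * (κ₃ / Λ ^ 4))) * (u ^ 2 * Λ ^ 6) ≤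
      (2 * a₁ * b₁ * g₀ * κ₂ * e₀ ^ 2 + b₁ ^ 2 * g₀ * κ₃ * e₀ ^ 2 + g₀ * g₂ * κ₂ * e₀ ^ 3 + a₂ * g₀ * κ₁ * e₀ ^ 2 + b₂ * g₀ * κ₂ * e₀ ^ 3 + g₁ ^ 2 * κ₂ * e₀ ^ 3 + 2 * a₁ * g₀ * g₁ * κ₂ * e₀ ^ 2 + 2 * b₁ * g₀ * g₁ * κ₃ * e₀ ^ 2 + g₀ * g₁ ^ 2 * κ₃ * e₀ ^ 2) * u := by
    have e : ((2 * (g₀ * u) * (κ₂ / Λ ^ 3) * (a₁ / Λ) * b₁ + (g₀ * u) * (κ₃ / Λ ^ 4) * b₁ ^ 2 + (g₀ * u) * (g₂ * u ^ 2) * (κ₂ / Λ ^ 3) + (g₀ * u) * (κ₁ / Λ ^ 2) * (a₂ / Λ ^ 2) + (g₀ * u) * (κ₂ / Λ ^ 3) * b₂ + (g₁ * u ^ 2) ^ 2 * (κ₂ / Λ ^ 3)) + (2 * (g₀ * u) * (g₁ * u ^ 2) * (κ₂ / Λ ^ 3) * (a₁ / Λ) + 2 * (g₀ * u) * (g₁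 * u ^ 2) * (κ₃ / Λ ^ 4) * b₁) + ((g₀ * u) * (g₁ * u ^ 2) ^ 2 * (κ₃ / Λ ^ 4))) * (u ^ 2 * Λ ^ 6) =
        (2 * a₁ * b₁ * g₀ * κ₂) * u ^ 3 * Λ ^ 2 + (b₁ ^ 2 * g₀ * κ₃) * u ^ 3 * Λ ^ 2 + (g₀ * g₂ * κ₂) * u ^ 5 * Λ ^ 3 + (a₂ * g₀ * κ₁) * u ^ 3 * Λ ^ 2 + (b₂ * g₀ * κ₂) * u ^ 3 * Λ ^ 3 + (g₁ ^ 2 * κ₂) * u ^ 6 * Λ ^ 3 + (2 * a₁ * g₀ * g₁ * κ₂) * u ^ 5 * Λ ^ 2 + (2 * b₁ * g₀ * g₁ * κ₃) * u ^ 5 * Λ ^ 2 + (g₀ * g₁ ^ 2 * κ₃) * u ^ 7 * Λ ^ 2 := by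
      field_simp
      ring
    rw [e]
    linarith only [t0, t1, t2, t3, t4, t5, t6, t7, t8]
  have hT : 1048576 * κ₁ * g₂ * e₀ ^ 4 ≤ κ₁ / Λ ^ 2 * (g₂ * u ^ 2) * x ^ 2 * (u ^ 2 * Λ ^ 6) := by
    have hxi : (1024 * e₀ ^ 2) ^ 2 ≤ (x * (u ^ 2 * Λ ^ 2)) ^ 2 := pow_le_pow_left₀ (by positivity) hx 2
    calc 1048576 * κ₁ * g₂ * e₀ ^ 4 = κ₁ * g₂ * (1024 * e₀ ^ 2) ^ 2 := by ring
      _ ≤ κ₁ * g₂ * (x * (u ^ 2 * Λ ^ 2)) ^ 2 := mul_le_mul_of_nonneg_left hxi (by positivity)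
      _ = κ₁ / Λ ^ 2 * (g₂ * u ^ 2) * x ^ 2 * (u ^ 2 * Λ ^ 6) := by field_simp
  have hw : 0 < (u ^ 2 * Λ ^ 6) := by positivity
  refine le_of_mul_le_mul_right ?_ hw
  calc 2 * ((2 * (g₀ * u) * (κ₂ / Λ ^ 3) * (a₁ / Λ) * b₁ + (g₀ * u) * (κ₃ / Λ ^ 4) * b₁ ^ 2 + (g₀ * u) * (g₂ * u ^ 2) * (κ₂ / Λ ^ 3) + (g₀ * u) * (κ₁ / Λ ^ 2) * (a₂ / Λ ^ 2) + (g₀ * u) * (κ₂ / Λ ^ 3) * b₂ + (g₁ * u ^ 2) ^ 2 * (κ₂ / Λ ^ 3)) + (2 * (g₀ * u) * (g₁ * u ^ 2) * (κ₂ / Λ ^ 3) * (a₁ / Λ) + 2 * (g₀ * u) * (g₁ * u ^ 2) * (κ₃ / Λ ^ 4) * b₁) + ((g₀ * u) * (g₁ * u ^ 2) ^ 2 * (κ₃ / Λ ^ 4))) * (u ^ 2 * Λ ^ 6) = 2 * (((2 * (g₀ * u) * (κ₂ / Λ ^ 3) * (a₁ / Λ) * b₁ + (g₀ * u) * (κ₃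 / Λ ^ 4) * b₁ ^ 2 + (g₀ * u) * (g₂ * u ^ 2) * (κ₂ / Λ ^ 3) + (g₀ * u) * (κ₁ / Λ ^ 2) * (a₂ / Λ ^ 2) + (g₀ * u) * (κ₂ / Λ ^ 3) * b₂ + (g₁ * u ^ 2) ^ 2 * (κ₂ / Λ ^ 3)) + (2 * (g₀ * u) * (g₁ * u ^ 2) * (κ₂ / Λ ^ 3) * (a₁ / Λ) + 2 * (g₀ * u) * (g₁ * u ^ 2) * (κ₃ / Λ ^ 4) * b₁) + ((g₀ * u) * (g₁ * u ^ 2) ^ 2 * (κ₃ / Λ ^ 4))) * (u ^ 2 * Λ ^ 6)) := by ring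
    _ ≤ 2 * ((2 * a₁ * b₁ * g₀ * κ₂ * e₀ ^ 2 + b₁ ^ 2 * g₀ * κ₃ * e₀ ^ 2 + g₀ * g₂ * κ₂ * e₀ ^ 3 + a₂ * g₀ * κ₁ * e₀ ^ 2 + b₂ * g₀ * κ₂ * e₀ ^ 3 + g₁ ^ 2 * κ₂ * e₀ ^ 3 + 2 * a₁ * g₀ * g₁ * κ₂ * e₀ ^ 2 + 2 * b₁ * g₀ * g₁ * κ₃ * e₀ ^ 2 + g₀ * g₁ ^ 2 * κ₃ * e₀ ^ 2) * u) := mul_le_mul_of_nonneg_left hS (by norm_num)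
    _ = 2 * (u * (2 * a₁ * b₁ * g₀ * κ₂ * e₀ ^ 2 + b₁ ^ 2 * g₀ * κ₃ * e₀ ^ 2 + g₀ * g₂ * κ₂ * e₀ ^ 3 + a₂ * g₀ * κ₁ * e₀ ^ 2 + b₂ * g₀ * κ₂ * e₀ ^ 3 + g₁ ^ 2 * κ₂ * e₀ ^ 3 + 2 * a₁ * g₀ * g₁ * κ₂ * e₀ ^ 2 + 2 * b₁ * g₀ * g₁ * κ₃ * e₀ ^ 2 + g₀ * g₁ ^ 2 * κ₃ * e₀ ^ 2)) := by ring
    _ ≤ 1048576 * κ₁ * g₂ * e₀ ^ 4 := hU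
    _ ≤ κ₁ / Λ ^ 2 * (g₂ * u ^ 2) * x ^ 2 * (u ^ 2 * Λ ^ 6) := hT

/-- **The (c-D) depth in closed form**: `m ≥ 2j + 5 + ⌈log₄ (U²)⁻¹⌉₊` (`= klCDBase U j` of `…EngineWtBudgetF`) gives `1024·e₀² ≤ 4^m·(U²·Λ_j²)`,
`Λ_j = klScale e₀ j = e₀·4^{−j}` (`0 < |U| ≤ 1`, `0 < e₀`) — the depth hypothesis of `cd_threshold_*`. -/
theorem cd_depth_lower {e₀ U : ℝ} (he : 0 < e₀) (hU : 0 < |U|) (hU1 : |U| ≤ 1) {j m : ℕ} (hm : 2 * j + 5 + ⌈Real.logb 4 (U ^ 2)⁻¹⌉₊ ≤ m) :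
    1024 * e₀ ^ 2 ≤ (4 : ℝ) ^ m * (|U| ^ 2 * (e₀ * ((4 : ℝ) ^ j)⁻¹) ^ 2) := by
  have hU2 : 0 < U ^ 2 := by rw [← sq_abs]; positivity
  have hU21 : U ^ 2 ≤ 1 := by rw [← sq_abs]; exact pow_le_one₀ (abs_nonneg _) hU1
  -- `4^{⌈log₄ (U²)⁻¹⌉₊} ≥ (U²)⁻¹`
  have hceil : (U ^ 2)⁻¹ ≤ (4 : ℝ) ^ ⌈Real.logb 4 (U ^ 2)⁻¹⌉₊ := by
    have hinv : 0 < (U ^ 2)⁻¹ := inv_pos.2 hU2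
    have h1 : Real.logb 4 (U ^ 2)⁻¹ ≤ (⌈Real.logb 4 (U ^ 2)⁻¹⌉₊ : ℝ) := Nat.le_ceil _
    have h3 : (4 : ℝ) ^ (Real.logb 4 (U ^ 2)⁻¹) ≤ (4 : ℝ) ^ ((⌈Real.logb 4 (U ^ 2)⁻¹⌉₊ : ℕ) : ℝ) :=
      Real.rpow_le_rpow_of_exponent_le (show (1 : ℝ) ≤ 4 by norm_num) h1
    rwa [Real.rpow_logb (by norm_num) (by norm_num) hinv, Real.rpow_natCast] at h3
  have h4m : (4 : ℝ) ^ (2 * j + 5 + ⌈Real.logb 4 (U ^ 2)⁻¹⌉₊) ≤ (4 : ℝ) ^ m := pow_le_pow_right₀ (by norm_num) hm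
  rw [pow_add, pow_add] at h4m
  have h4j : 0 < (4 : ℝ) ^ j := by positivity
  -- `1024 e₀² = 4^{2j+5} · (U²·Λ_j²) · (U²)⁻¹ ≤ 4^m · (U²Λ_j²)`
  have hU0 : U ≠ 0 := fun h => by rw [h, abs_zero] at hU; exact lt_irrefl _ hU
  have key : 1024 * e₀ ^ 2 = (4 : ℝ) ^ (2 * j) * (4 : ℝ) ^ 5 * (U ^ 2)⁻¹ * (|U| ^ 2 * (e₀ * ((4 : ℝ) ^ j)⁻¹) ^ 2) := by
    rw [sq_abs, pow_mul']; field_simp; ring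
  rw [key]
  have hW : 0 ≤ |U| ^ 2 * (e₀ * ((4 : ℝ) ^ j)⁻¹) ^ 2 := by positivity
  calc (4 : ℝ) ^ (2 * j) * (4 : ℝ) ^ 5 * (U ^ 2)⁻¹ * (|U| ^ 2 * (e₀ * ((4 : ℝ) ^ j)⁻¹) ^ 2)
      ≤ (4 : ℝ) ^ (2 * j) * (4 : ℝ) ^ 5 * (4 : ℝ) ^ ⌈Real.logb 4 (U ^ 2)⁻¹⌉₊ * (|U| ^ 2 * (e₀ * ((4 : ℝ) ^ j)⁻¹) ^ 2) := by
        gcongr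
    _ ≤ (4 : ℝ) ^ m * (|U| ^ 2 * (e₀ * ((4 : ℝ) ^ j)⁻¹) ^ 2) := mul_le_mul_of_nonneg_right h4m hW

end Summit.HubbardSuperconductivity.HubbardSuperconductivity.Theorems.EngineV8

end
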